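import Mathlib
import Literature.AlgebraicGeometry.Resolution.ProperModelsPatching
import Literature.AlgebraicGeometry.Resolution.ZariskiPatchingProperModels

/-!
# Crux `PatchingRel` (stmt-ResolutionOfSingularities-0642), line `sandwiched-gluing`,
# stub `stub_resolutionInChar_of_properPatching`

Zariski's resolving-system argument with PROPER models: two-model patching of proper models over
fields of characteristic `p` (`ProperModel.TwoModelPatching p`, `ProperModelsPatching.lean`)
together with relative local uniformization `LUrel_p` (the antecedent of the crux, verbatim) gives
`ResolutionInChar.{0} p`. This is the tree theorem
`Literature.AlgebraicGeometry.Resolution.resolutionInChar_of_properTwoModelPatching_of_relLU`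
(`ZariskiPatchingProperModels.lean`), whose first hypothesis is `ProperModel.TwoModelPatching p`
unfolded.
-/

noncomputable section

open CategoryTheory AlgebraicGeometry
open Literature.AlgebraicGeometry.Resolution

-- `Summit.<Summit>.<Sub>.Theorems` with `Sub = Summit` (single-conjunct summit, D-0017): the duplicated
-- namespace component is the tree layout.
set_option linter.dupNamespace false

namespace Summit.ResolutionOfSingularities.ResolutionOfSingularities.Theorems

/-- **Stub `stub_resolutionInChar_of_properPatching` of line `sandwiched-gluing`** (crux
`PatchingRel`, stmt-ResolutionOfSingularities-0642): in characteristic `p`, two-model patching of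
PROPER models (`ProperModel.TwoModelPatching p`) and relative local uniformization `LUrel_p` (the
antecedent of the crux, verbatim) give `ResolutionInChar.{0} p` — Zariski's compactness /
resolving-system argument is dimension-free and needs only proper models
(`resolutionInChar_of_properTwoModelPatching_of_relLU`). [cite: Piltant2013, p. 2 and Prop. 5.1] -/
theorem stub_resolutionInChar_of_properPatching : ∀ p : ℕ, p.Prime →
    ProperModel.TwoModelPatching.{0} p →
    (∀ (k K : Type) [Field k] [CharP k p] [Field K] [Algebra k K],
      (⊤ : IntermediateField k K).FG → ∀ O : ValuationSubring K,
        (∀ c : k, algebraMap k K c ∈ O) → ∀ R : Subalgebra k K, R.FG →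
          R.toSubring ≤ O.toSubring →
            ∃ (A : Subalgebra k K) (h : A.toSubring ≤ O.toSubring), R ≤ A ∧ A.FG ∧
              IsFractionRing A K ∧ IsRegularLocalRing (Localization.AtPrime
                (Ideal.comap (Subring.inclusion h) (IsLocalRing.maximalIdeal O)))) →
    ResolutionInChar.{0} p :=
  fun _ _ hZ hLU => resolutionInChar_of_properTwoModelPatching_of_relLU
    (fun k _ _ K _ _ _ => hZ k K) hLU

end Summit.ResolutionOfSingularities.ResolutionOfSingularities.Theorems

end
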